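import Literature.Topology.PlanarFoliations.PolygonLeafPath
import Literature.Topology.PlanarFoliations.WalkFence
import HarnessLib

/-!
# The image of a walk as paths of the leaf space of `T`; the base loop as a conjugate

Topic: Topology / PlanarFoliations, sequel to `WalkFence.lean` (the base horizontal `walkBase` of
the walk fence of a walk `J`, `ℓ` of the separatrix graph, assembled by `transFun`) and
`PolygonLeafPath.lean` (prong arcs are mapped by `g` into one plaque, hence continuously into
the leaf space of `T`). We realise the image under `g` of a walk as **paths of the leaf space
`T.LeafSpace`**: the in-prong path `inP` (from the incoming prong point to the puncture), the
out-prong path `outP`, the gate `gateP = (inP · refl) · outP` (pointwise `g ∘ gateBase`), the link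
`linkP` (`g ∘ ι ∘ ℓ k` with constant ends, pointwise the link piece of `walkBase`), the **base
path** `baseP n` (pointwise `g ∘ walkBase J ℓ n`, `baseP_apply`) and the **steps**
`stepP k = (outP k · linkP k) · inP (k + 1)` from puncture to puncture with their left-nested
product `chainL n`. The homotopy algebra of the fundamental groupoid gives
`baseP n · inP n ≃ inP 0 · chainL n` (`baseP_trans_inP`), and for a closed walk: **if the chain of
steps is homotopic to a constant path then the base loop is null-homotopic**
(`exists_base_null_of_chain`), in the form consumed by `WalkNullTransport.lean` /
`HugDegree.lean`.

All statements are [folklore].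
-/

noncomputable section

open Set Filter Function Metric unitInterval
open _root_.Topology
open Literature.Topology.FourManifolds Literature.Topology.FourManifolds.Foliation

namespace Literature.Topology.PlanarFoliations

/-! ## Small facts on homotopy of paths -/

section PathFacts

variable {Y : Type*} [TopologicalSpace Y] {a b c d : Y}

/-- Casting preserves homotopy. [folklore] -/
theorem Path.Homotopic.cast' {p q : Path a b} (h : p.Homotopic q) {a' b' : Y} (ha : a' = a) (hb : b' = b) :
    (p.cast ha hb).Homotopic (q.cast ha hb) := by
  subst ha hb; exact h

/-- A path pointwise equal to a constant is the constant path. [folklore] -/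
theorem Path.eq_refl_of_forall_eq {p : Path a a} (h : ∀ θ, p θ = a) : p = Path.refl a := Path.ext (funext h)

/-- Paths with the same values are equal. [folklore] -/
theorem Path.eq_of_forall_eq {p q : Path a b} (h : ∀ θ, p θ = q θ) : p = q := Path.ext (funext h)

/-- `(p · q) · r ≃ p · (q · r)`. [folklore] -/
theorem Path.Homotopic.assoc (p : Path a b) (q : Path b c) (r : Path c d) :
    ((p.trans q).trans r).Homotopic (p.trans (q.trans r)) := ⟨Path.Homotopy.transAssoc p q r⟩

/-- `refl · p ≃ p`. [folklore] -/
theorem Path.Homotopic.refl_trans' (p : Path a b) : ((Path.refl a).trans p).Homotopic p := ⟨Path.Homotopy.reflTrans p⟩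

/-- `p · refl ≃ p`. [folklore] -/
theorem Path.Homotopic.trans_refl' (p : Path a b) : (p.trans (Path.refl b)).Homotopic p := ⟨Path.Homotopy.transRefl p⟩

/-- `p · p⁻¹ ≃ refl`. [folklore] -/
theorem Path.Homotopic.trans_symm' (p : Path a b) : (p.trans p.symm).Homotopic (Path.refl a) := ⟨(Path.Homotopy.reflTransSymm p).symm⟩

/-- **Cancelling on the right**: `base · e ≃ e` for a path `e` implies `base ≃ refl`. [folklore] -/
theorem Path.Homotopic.refl_of_trans_right {base : Path a a} {e : Path a b} (h : (base.trans e).Homotopic e) :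
    base.Homotopic (Path.refl a) := by
  have h1 : base.Homotopic (base.trans (Path.refl a)) := (Path.Homotopic.trans_refl' base).symm
  have h2 : (base.trans (Path.refl a)).Homotopic (base.trans (e.trans e.symm)) :=
    (Path.Homotopic.refl _).hcomp (Path.Homotopic.trans_symm' e).symm
  have h3 : (base.trans (e.trans e.symm)).Homotopic ((base.trans e).trans e.symm) := (Path.Homotopic.assoc _ _ _).symm
  have h4 : ((base.trans e).trans e.symm).Homotopic (e.trans e.symm) := h.hcomp (Path.Homotopic.refl _)
  exact (((h1.trans h2).trans h3).trans h4).trans (Path.Homotopic.trans_symm' e)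

end PathFacts

variable {X : Type*} [TopologicalSpace X] [Nonempty X] {F : Foliation ℝ X} {ι : X → ℂ}
variable {B : Type*} [NormedAddCommGroup B] {M : Type*} [TopologicalSpace M] {T : Foliation B M} {g : ℂ → M}

namespace StarData

variable {D : StarData F ι T g} {hι : IsOpenEmbedding ι}

/-- The placement of plane points in the leaf space of `T`. [folklore] -/
def pos (_D : StarData F ι T g) (z : ℂ) : T.LeafSpace := toLeafSpace (g z)

omit [Nonempty X] in
/-- The point under a placed point. [folklore] -/
@[simp] theorem ofLeafSpace_pos (z : ℂ) : ofLeafSpace (D.pos z) = g z := rfl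

/-! ## Junction level: in-prong, out-prong, gate -/

namespace WalkJunction

variable (J₀ : D.WalkJunction hι)

/-- The incoming prong point of the junction, in the plane. [folklore] -/
def xpt : ℂ := (D.star J₀.v J₀.hv).pt J₀.jin (J₀.β, 0)

/-- The outgoing prong point of the junction, in the plane. [folklore] -/
def ypt : ℂ := (D.star J₀.v J₀.hv).pt J₀.jout (J₀.β, 0)

/-- The incoming prong point is the image of the base of the incoming box. [folklore] -/
theorem ι_Kin_base : ι J₀.Kin.base = J₀.xpt := J₀.Kin.ι_base

/-- The outgoing prong point is the image of the base of the outgoing box. [folklore] -/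
theorem ι_Kout_base : ι J₀.Kout.base = J₀.ypt := J₀.Kout.ι_base

/-- `g` of a prong path `θ ↦ pt j (b θ, 0)`, `b θ ∈ [0, ρ]`, is continuous into the leaf space of
`T`. [folklore] -/
theorem continuous_toLeafSpace_g_prong (j : ZMod (D.nprong J₀.v)) {b : I → ℝ} (hb : Continuous b)
    (hmem : ∀ θ, b θ ∈ Icc 0 (D.star J₀.v J₀.hv).ρ) :
    Continuous (toLeafSpace ∘ fun θ ↦ g ((D.star J₀.v J₀.hv).pt j (b θ, 0)) : I → T.LeafSpace) := by
  set P := D.star J₀.v J₀.hv with hP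
  have hvP : J₀.v ∈ D.P := D.mem_P _ J₀.hv
  have hrect : ∀ θ, ((b θ, 0) : ℝ × ℝ) ∈ P.rect := fun θ ↦ (P.mem_rect_iff).2 ⟨hmem θ, by simp [P.ρ_pos.le]⟩
  have hplaque : ∀ θ, g (P.pt j (b θ, 0)) ∈ plaque (D.box J₀.v) (D.level J₀.v J₀.v) := fun θ ↦ D.g_pt_mem_plaque J₀.hv j (hmem θ)
  refine T.continuous_toLeafSpace_comp_of_forall_mem_plaque ?_ (D.box_mem _ hvP) hplaque
  have hc : Continuous fun θ ↦ P.pt j (b θ, 0) :=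
    (P.continuousOn_pt j).comp_continuous (hb.prodMk continuous_const) hrect
  exact D.continuousOn.comp_continuous hc fun θ ↦ D.ball_subset _ hvP (D.mem_ball_of_mem_S J₀.hv (P.pt_mem (hrect θ)))

/-- **The in-prong path**: from the incoming prong point to the puncture, in the leaf space of `T`.
[folklore] -/
def inP : Path (D.pos J₀.xpt) (D.pos J₀.v) where
  toFun θ := toLeafSpace (g ((D.star J₀.v J₀.hv).pt J₀.jin (βline J₀.β 0 θ, 0)))
  continuous_toFun := J₀.continuous_toLeafSpace_g_prong J₀.jin (by unfold βline; fun_prop)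
    fun θ ↦ βline_mem J₀.hβ ⟨le_rfl, (D.star J₀.v J₀.hv).ρ_pos.le⟩ θ
  source' := by simp only [βline_zero]; rfl
  target' := by simp only [βline_one, Prod.mk_zero_zero, ProngStar.pt_zero]; rfl

/-- **The out-prong path**: from the puncture to the outgoing prong point. [folklore] -/
def outP : Path (D.pos J₀.v) (D.pos J₀.ypt) where
  toFun θ := toLeafSpace (g ((D.star J₀.v J₀.hv).pt J₀.jout (βline 0 J₀.β θ, 0)))
  continuous_toFun := J₀.continuous_toLeafSpace_g_prong J₀.jout (by unfold βline; fun_prop)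
    fun θ ↦ βline_mem ⟨le_rfl, (D.star J₀.v J₀.hv).ρ_pos.le⟩ J₀.hβ θ
  source' := by simp only [βline_zero, Prod.mk_zero_zero, ProngStar.pt_zero]; rfl
  target' := by simp only [βline_one]; rfl

/-- The values of the in-prong path. [folklore] -/
theorem inP_apply (θ : I) : J₀.inP θ = toLeafSpace (g ((D.star J₀.v J₀.hv).pt J₀.jin (βline J₀.β 0 θ, 0))) := rfl

/-- The values of the out-prong path. [folklore] -/
theorem outP_apply (θ : I) : J₀.outP θ = toLeafSpace (g ((D.star J₀.v J₀.hv).pt J₀.jout (βline 0 J₀.β θ, 0))) := rfl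

/-- **The gate path**: in-prong, the puncture, out-prong (pointwise `g ∘ gateBase`). [folklore] -/
def gateP : Path (D.pos J₀.xpt) (D.pos J₀.ypt) := (J₀.inP.trans (Path.refl _)).trans J₀.outP

/-- The gate path is `g` of the base horizontal of the gate, pointwise. [folklore] -/
theorem gateP_apply (θ : I) : J₀.gateP θ = toLeafSpace (J₀.gateBase θ) := by
  rw [gateP, Path.trans_apply_eq_transFun, gateBase, ← transFun_map (toLeafSpace : M → T.LeafSpace)]
  refine transFun_congr (fun θ' ↦ ?_) (fun θ' ↦ rfl) θ
  rw [Path.trans_apply_eq_transFun, ← transFun_map (toLeafSpace : M → T.LeafSpace)]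
  exact transFun_congr (fun _ ↦ rfl) (fun _ ↦ rfl) θ'

/-- The gate path is homotopic to in-prong then out-prong. [folklore] -/
theorem gateP_homotopic : J₀.gateP.Homotopic (J₀.inP.trans J₀.outP) :=
  (Path.Homotopic.trans_refl' J₀.inP).hcomp (Path.Homotopic.refl _)

end WalkJunction

/-! ## Walk level: links, steps, the base path and the chain of steps -/

section Walk

variable (J : ℕ → D.WalkJunction hι) (ℓ : ∀ k, Path (J k).Kout.base (J (k + 1)).Kin.base)
  (hℓ : ∀ k, Continuous (toLeafSpace ∘ ℓ k : I → F.LeafSpace))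

/-- **The link path** `g ∘ ι ∘ ℓ k`, in the leaf space of `T` (a leaf path: `g ∘ ι` is foliated).
[folklore] -/
def ℓT (k : ℕ) : Path (D.pos (J k).ypt) (D.pos (J (k + 1)).xpt) where
  toFun θ := toLeafSpace (g (ι (ℓ k θ)))
  continuous_toFun := D.foliated.continuous_leafMap.comp (hℓ k)
  source' := by show D.pos (ι (ℓ k 0)) = _; rw [(ℓ k).source, (J k).ι_Kout_base]
  target' := by show D.pos (ι (ℓ k 1)) = _; rw [(ℓ k).target, (J (k + 1)).ι_Kin_base]

/-- The values of the link path. [folklore] -/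
theorem ℓT_apply (k : ℕ) (θ : I) : D.ℓT J ℓ hℓ k θ = toLeafSpace (g (ι (ℓ k θ))) := rfl

/-- **The link path with constant ends** (pointwise the link piece of `walkBase`). [folklore] -/
def linkP (k : ℕ) : Path (D.pos (J k).ypt) (D.pos (J (k + 1)).xpt) := ((Path.refl _).trans (D.ℓT J ℓ hℓ k)).trans (Path.refl _)

/-- The link path with constant ends, pointwise. [folklore] -/
theorem linkP_apply (k : ℕ) (θ : I) :
    D.linkP J ℓ hℓ k θ = toLeafSpace (g (ι (transFun (transFun (fun _ ↦ (J k).Kout.base) (ℓ k)) (fun _ ↦ (J (k + 1)).Kin.base) θ))) := by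
  rw [linkP, Path.trans_apply_eq_transFun, ← transFun_map (fun x ↦ (toLeafSpace (g (ι x)) : T.LeafSpace))]
  refine transFun_congr (fun θ' ↦ ?_) (fun θ' ↦ ?_) θ
  · rw [Path.trans_apply_eq_transFun, ← transFun_map (fun x ↦ (toLeafSpace (g (ι x)) : T.LeafSpace))]
    refine transFun_congr (fun _ ↦ ?_) (fun _ ↦ rfl) θ'
    show D.pos (J k).ypt = D.pos (ι (J k).Kout.base)
    rw [(J k).ι_Kout_base]
  · show D.pos (J (k + 1)).xpt = D.pos (ι (J (k + 1)).Kin.base)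
    rw [(J (k + 1)).ι_Kin_base]

/-- The link path with constant ends is homotopic to the link path. [folklore] -/
theorem linkP_homotopic (k : ℕ) : (D.linkP J ℓ hℓ k).Homotopic (D.ℓT J ℓ hℓ k) :=
  (Path.Homotopic.trans_refl' _).trans (Path.Homotopic.refl_trans' _)

/-- **The step path** from the puncture of `J k` to the puncture of `J (k + 1)`: out-prong, link,
in-prong. [folklore] -/
def stepP (k : ℕ) : Path (D.pos (J k).v) (D.pos (J (k + 1)).v) := ((J k).outP.trans (D.linkP J ℓ hℓ k)).trans (J (k + 1)).inP

/-- **The base path** of the walk up to the junction `n` (pointwise `g ∘ walkBase J ℓ n`).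
[folklore] -/
def baseP : (n : ℕ) → Path (D.pos (J 0).xpt) (D.pos (J n).xpt)
  | 0 => Path.refl _
  | n + 1 => ((baseP n).trans (J n).gateP).trans (D.linkP J ℓ hℓ n)

/-- **The base path is `g` of the base horizontal of the walk fence, pointwise.** [folklore] -/
theorem baseP_apply (n : ℕ) (θ : I) : D.baseP J ℓ hℓ n θ = toLeafSpace (D.walkBase J ℓ n θ) := by
  induction n generalizing θ with
  | zero => rfl
  | succ n ih =>
    show (((D.baseP J ℓ hℓ n).trans (J n).gateP).trans (D.linkP J ℓ hℓ n)) θ =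
      toLeafSpace (transFun (transFun (D.walkBase J ℓ n) (J n).gateBase)
        (fun θ ↦ g (ι (transFun (transFun (fun _ ↦ (J n).Kout.base) (ℓ n)) (fun _ ↦ (J (n + 1)).Kin.base) θ))) θ)
    rw [Path.trans_apply_eq_transFun, ← transFun_map (toLeafSpace : M → T.LeafSpace)]
    refine transFun_congr (fun θ' ↦ ?_) (fun θ' ↦ D.linkP_apply J ℓ hℓ n θ') θ
    rw [Path.trans_apply_eq_transFun, ← transFun_map (toLeafSpace : M → T.LeafSpace)]
    exact transFun_congr (fun θ'' ↦ ih θ'') (fun θ'' ↦ (J n).gateP_apply θ'') θ'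

/-- **The chain of steps** up to the junction `n`, left-nested. [folklore] -/
def chainL : (n : ℕ) → Path (D.pos (J 0).v) (D.pos (J n).v)
  | 0 => Path.refl _
  | n + 1 => (chainL n).trans (D.stepP J ℓ hℓ n)

/-- **The base path is the chain of steps conjugated by the first in-prong**:
`baseP n · inP n ≃ inP 0 · chainL n`. [folklore] -/
theorem baseP_trans_inP (n : ℕ) : ((D.baseP J ℓ hℓ n).trans (J n).inP).Homotopic ((J 0).inP.trans (D.chainL J ℓ hℓ n)) := by
  induction n with
  | zero => exact (Path.Homotopic.refl_trans' _).trans (Path.Homotopic.trans_refl' _).symm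
  | succ n ih =>
    -- `((base · gate) · link) · in' ≃ base · (gate · (link · in')) ≃ base · (in · (out · (link · in')))`
    have h1 : ((((D.baseP J ℓ hℓ n).trans (J n).gateP).trans (D.linkP J ℓ hℓ n)).trans (J (n + 1)).inP).Homotopic
        ((D.baseP J ℓ hℓ n).trans ((J n).gateP.trans ((D.linkP J ℓ hℓ n).trans (J (n + 1)).inP))) :=
      (Path.Homotopic.assoc _ _ _).trans (Path.Homotopic.assoc _ _ _)
    have h2 : ((J n).gateP.trans ((D.linkP J ℓ hℓ n).trans (J (n + 1)).inP)).Homotopic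
        ((J n).inP.trans ((J n).outP.trans ((D.linkP J ℓ hℓ n).trans (J (n + 1)).inP))) :=
      ((J n).gateP_homotopic.hcomp (Path.Homotopic.refl _)).trans (Path.Homotopic.assoc _ _ _)
    have h3 : ((J n).outP.trans ((D.linkP J ℓ hℓ n).trans (J (n + 1)).inP)).Homotopic (D.stepP J ℓ hℓ n) :=
      (Path.Homotopic.assoc _ _ _).symm
    -- `base · (in · step) ≃ (base · in) · step ≃ (in₀ · chain) · step ≃ in₀ · (chain · step)`
    have h4 : ((D.baseP J ℓ hℓ n).trans ((J n).inP.trans (D.stepP J ℓ hℓ n))).Homotopic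
        (((D.baseP J ℓ hℓ n).trans (J n).inP).trans (D.stepP J ℓ hℓ n)) := (Path.Homotopic.assoc _ _ _).symm
    have h5 : (((D.baseP J ℓ hℓ n).trans (J n).inP).trans (D.stepP J ℓ hℓ n)).Homotopic
        (((J 0).inP.trans (D.chainL J ℓ hℓ n)).trans (D.stepP J ℓ hℓ n)) := ih.hcomp (Path.Homotopic.refl _)
    have h6 : (((J 0).inP.trans (D.chainL J ℓ hℓ n)).trans (D.stepP J ℓ hℓ n)).Homotopic
        ((J 0).inP.trans ((D.chainL J ℓ hℓ n).trans (D.stepP J ℓ hℓ n))) := Path.Homotopic.assoc _ _ _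
    exact h1.trans ((((Path.Homotopic.refl _).hcomp (h2.trans ((Path.Homotopic.refl _).hcomp h3))).trans h4).trans (h5.trans h6))

/-- **Closing up**: if the last junction is the first one, and the chain of steps is homotopic to
a constant path, then the base loop is null-homotopic. [folklore] -/
theorem exists_base_null_of_chain {m : ℕ} (hper : J m = J 0) (R : Path (D.pos (J 0).v) (D.pos (J m).v)) (hR : ∀ θ, R θ = D.pos (J 0).v)
    (hchain : (D.chainL J ℓ hℓ m).Homotopic R) :
    ∃ (p : T.LeafSpace) (L : Path p p), (∀ θ, L θ = toLeafSpace (D.walkBase J ℓ m θ)) ∧ L.Homotopic (Path.refl p) := by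
  have hA := D.baseP_trans_inP J ℓ hℓ m
  -- generalise the last junction
  have key : ∀ (Jm : D.WalkJunction hι) (h : Jm = J 0) (base : Path (D.pos (J 0).xpt) (D.pos Jm.xpt))
      (R : Path (D.pos (J 0).v) (D.pos Jm.v)), (∀ θ, R θ = D.pos (J 0).v) → (base.trans Jm.inP).Homotopic ((J 0).inP.trans R) →
      ∃ (p : T.LeafSpace) (L : Path p p), (∀ θ, L θ = base θ) ∧ L.Homotopic (Path.refl p) := by
    intro Jm h base R hR hbase
    subst h
    have hR' : R = Path.refl _ := Path.eq_refl_of_forall_eq hR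
    rw [hR'] at hbase
    refine ⟨_, base, fun θ ↦ rfl, ?_⟩
    exact Path.Homotopic.refl_of_trans_right (hbase.trans (Path.Homotopic.trans_refl' _))
  obtain ⟨p, L, hL, hLnull⟩ := key (J m) hper (D.baseP J ℓ hℓ m) R hR (hA.trans ((Path.Homotopic.refl _).hcomp hchain))
  exact ⟨p, L, fun θ ↦ (hL θ).trans (D.baseP_apply J ℓ hℓ m θ), hLnull⟩

end Walk

end StarData

end Literature.Topology.PlanarFoliations
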